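import Mathlib.Analysis.Complex.CauchyIntegral
import Mathlib.Analysis.Analytic.Order
import Mathlib.Analysis.Analytic.IsolatedZeros
import Mathlib.Analysis.Meromorphic.Basic
import Mathlib.Analysis.Calculus.Deriv.ZPow
import Mathlib.Analysis.Calculus.DSlope
import HarnessLib

/-!
# Residues at isolated singularities via small circle integrals

Mathlib (rev. 2026) integrates over circles (`circleIntegral`, `∮ z in C(c, r), f z`) and proves
Cauchy's theorem and formula for discs and annuli (`Mathlib.Analysis.Complex.CauchyIntegral`), but
has no notion of the *residue of a function at a point*. This file supplies the elementary theory
needed by the residue calculus on modular curves (`Literature/NumberTheory/EllipticCurves/`,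
the Riemann–Roch bridge to `dim S₂(Γ₀(N))`):

* `Literature.Complex.circleResidue f c r = (2πi)⁻¹ ∮_{|z−c|=r} f` and its independence of `r` for `f`
  holomorphic on a punctured disc (`circleResidue_eq_of_differentiableOn`, Cauchy on an annulus);
* `Literature.Complex.residueAt f c = lim_{r → 0⁺} circleResidue f c r`, computed by any small circle
  (`residueAt_eq_circleResidue`);
* vanishing for holomorphic germs (`residueAt_of_differentiableOn`, `residueAt_of_analyticAt`),
  dependence on the punctured germ only (`residueAt_congr`), linearity (`residueAt_add`,
  `residueAt_const_mul`, `residueAt_neg`, `residueAt_sub`, `residueAt_sum`);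
* the model residues `Res_c (z−c)⁻¹ = 1`, `Res_c (z−c)ⁿ = 0` (`n ≠ −1`)
  (`residueAt_inv_sub_self`, `residueAt_zpow_sub_self`, from Mathlib's circle integrals);
* `Res_c F' = 0` for `F` holomorphic on a punctured neighbourhood (`residueAt_deriv`);
* the logarithmic derivative: `Res_c f'/f = m` for `f = (z−c)^m g`, `g(c) ≠ 0`
  (`residueAt_logDeriv_of_eventuallyEq`, `residueAt_logDeriv`);
* Taylor truncation and principal parts of meromorphic germs (`exists_taylor_truncation`,
  `exists_principalPart`) and **the residue as the coefficient of `(z−c)⁻¹`**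
  (`residueAt_eq_of_principalPart`).

All statements are classical (Ahlfors, *Complex Analysis*, 3rd ed., Ch. 4 §5; Conway, *Functions of
One Complex Variable I*, §V.2) and tagged `[folklore]`.
-/

noncomputable section

open Complex MeasureTheory Filter Metric Set Topology
open scoped Real

namespace Literature.Analysis.Complex


/-! ### Circle residues and their independence of the radius -/

/-- The **circle residue** `(2πi)⁻¹ ∮_{|z−c|=r} f(z) dz`. [folklore] -/
def circleResidue (f : ℂ → ℂ) (c : ℂ) (r : ℝ) : ℂ :=
  (2 * π * I)⁻¹ * ∮ z in C(c, r), f z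

/-- Points of a punctured disc from membership in an annulus/sphere (bookkeeping). [folklore] -/
theorem mem_ball_diff_singleton {c z : ℂ} {R r₁ : ℝ} (h₁ : 0 < r₁) (hz₁ : r₁ ≤ dist z c) (hz₂ : dist z c < R) :
    z ∈ ball c R \ {c} := by
  refine ⟨mem_ball.mpr hz₂, fun h0 ↦ ?_⟩
  rw [mem_singleton_iff] at h0
  rw [h0, dist_self] at hz₁
  linarith

/-- A function holomorphic on a punctured disc has the same integral over all small circles
(Cauchy's theorem on an annulus). [folklore] -/
theorem circleResidue_eq_of_differentiableOn {f : ℂ → ℂ} {c : ℂ} {R r₁ r₂ : ℝ}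
    (hf : DifferentiableOn ℂ f (ball c R \ {c})) (h₁ : 0 < r₁) (h₁₂ : r₁ ≤ r₂) (h₂ : r₂ < R) :
    circleResidue f c r₂ = circleResidue f c r₁ := by
  unfold circleResidue
  congr 1
  refine circleIntegral_eq_of_differentiable_on_annulus_off_countable h₁ h₁₂ countable_empty ?_ ?_
  · refine hf.continuousOn.mono fun z hz ↦ ?_
    exact mem_ball_diff_singleton h₁ (by simpa [mem_ball, not_lt] using hz.2)
      (lt_of_le_of_lt (mem_closedBall.mp hz.1) h₂)
  · intro z hz
    refine hf.differentiableAt ((isOpen_ball.sdiff isClosed_singleton).mem_nhds ?_)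
    have h1 : r₁ < dist z c := by simpa [mem_closedBall, not_le] using hz.1.2
    exact mem_ball_diff_singleton h₁ h1.le (lt_of_lt_of_le (mem_ball.mp hz.1.1) h₂.le)

/-- **The residue** `Res_c f` of a function at a point: the common value of the circle residues
`(2πi)⁻¹ ∮_{|z−c|=r} f` for small `r` (a junk limit if `f` is not holomorphic on a punctured
neighbourhood) (Ahlfors, *Complex Analysis*, Ch. 4 §5.1; Conway V §2). Mathlib has no residue at a
point (only integrals over circles and rectangles), whence this definition. [folklore] -/
def residueAt (f : ℂ → ℂ) (c : ℂ) : ℂ :=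
  limUnder (𝓝[>] (0 : ℝ)) (circleResidue f c)

/-- From a property on a punctured neighbourhood, a punctured disc where it holds. [folklore] -/
theorem exists_ball_forall_of_eventually {c : ℂ} {p : ℂ → Prop} (h : ∀ᶠ z in 𝓝[≠] c, p z) :
    ∃ R > 0, ∀ z ∈ ball c R \ {c}, p z := by
  rw [eventually_nhdsWithin_iff, Metric.eventually_nhds_iff] at h
  obtain ⟨R, hR, h⟩ := h
  exact ⟨R, hR, fun z hz ↦ h (mem_ball.mp hz.1) hz.2⟩

/-- Conversely a punctured disc is a punctured neighbourhood. [folklore] -/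
theorem eventually_of_forall_ball {c : ℂ} {p : ℂ → Prop} {R : ℝ} (hR : 0 < R)
    (h : ∀ z ∈ ball c R \ {c}, p z) : ∀ᶠ z in 𝓝[≠] c, p z := by
  rw [eventually_nhdsWithin_iff, Metric.eventually_nhds_iff]
  exact ⟨R, hR, fun z hz hzc ↦ h z ⟨mem_ball.mpr hz, hzc⟩⟩

/-- **The residue is computed by any small circle**: if `f` is holomorphic on `0 < |z − c| < R`
then `Res_c f = (2πi)⁻¹∮_{|z−c|=r} f` for every `0 < r < R`. [folklore] -/
theorem residueAt_eq_circleResidue {f : ℂ → ℂ} {c : ℂ} {R r : ℝ}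
    (hf : DifferentiableOn ℂ f (ball c R \ {c})) (hr : 0 < r) (hrR : r < R) :
    residueAt f c = circleResidue f c r := by
  refine Tendsto.limUnder_eq ?_
  refine tendsto_const_nhds.congr' ?_
  have : Ioo (0 : ℝ) r ∈ 𝓝[>] (0 : ℝ) := Ioo_mem_nhdsGT hr
  filter_upwards [this] with s hs
  exact circleResidue_eq_of_differentiableOn hf hs.1 hs.2.le hrR

/-! ### Basic properties -/

/-- **Holomorphic functions have residue `0`** (Cauchy–Goursat). [folklore] -/
theorem residueAt_of_differentiableOn {f : ℂ → ℂ} {c : ℂ} {R : ℝ} (hR : 0 < R)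
    (hf : DifferentiableOn ℂ f (ball c R)) : residueAt f c = 0 := by
  have hf' : DifferentiableOn ℂ f (ball c R \ {c}) := hf.mono sdiff_subset
  rw [residueAt_eq_circleResidue hf' (half_pos hR) (half_lt_self hR), circleResidue]
  rw [circleIntegral_eq_zero_of_differentiable_on_off_countable (half_pos hR).le countable_empty
    (hf.continuousOn.mono (closedBall_subset_ball (half_lt_self hR)))
    (fun z hz ↦ hf.differentiableAt (isOpen_ball.mem_nhds (ball_subset_ball (half_lt_self hR).le hz.1))),
    mul_zero]

/-- Residue `0` for a function holomorphic at the point (filter form). [folklore] -/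
theorem residueAt_of_eventually_differentiableAt {f : ℂ → ℂ} {c : ℂ}
    (hf : ∀ᶠ z in 𝓝 c, DifferentiableAt ℂ f z) : residueAt f c = 0 := by
  rw [Metric.eventually_nhds_iff] at hf
  obtain ⟨R, hR, h⟩ := hf
  exact residueAt_of_differentiableOn hR fun z hz ↦ (h (mem_ball.mp hz)).differentiableWithinAt

/-- Analytic functions have residue `0`. [folklore] -/
theorem residueAt_of_analyticAt {f : ℂ → ℂ} {c : ℂ} (hf : AnalyticAt ℂ f c) : residueAt f c = 0 :=
  residueAt_of_eventually_differentiableAt (hf.eventually_analyticAt.mono fun _ h ↦ h.differentiableAt)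

/-- A function equal to a holomorphic one on a punctured disc is holomorphic there. [folklore] -/
theorem differentiableOn_punctured_congr {f g : ℂ → ℂ} {c : ℂ} {R : ℝ}
    (hf : ∀ z ∈ ball c R \ {c}, DifferentiableAt ℂ f z) (h : ∀ z ∈ ball c R \ {c}, f z = g z) :
    DifferentiableOn ℂ g (ball c R \ {c}) := by
  intro z hz
  have hopen : ball c R \ {c} ∈ 𝓝 z := (isOpen_ball.sdiff isClosed_singleton).mem_nhds hz
  have heq : f =ᶠ[𝓝 z] g := by
    filter_upwards [hopen] with w hw using h w hw
  exact (heq.differentiableAt_iff.mp (hf z hz)).differentiableWithinAt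

/-- **The residue only depends on the germ on a punctured neighbourhood.** [folklore] -/
theorem residueAt_congr {f g : ℂ → ℂ} {c : ℂ} (hf : ∀ᶠ z in 𝓝[≠] c, DifferentiableAt ℂ f z)
    (h : f =ᶠ[𝓝[≠] c] g) : residueAt g c = residueAt f c := by
  have h2 : ∀ᶠ z in 𝓝[≠] c, f z = g z := h
  obtain ⟨R, hR, hRh⟩ := exists_ball_forall_of_eventually (hf.and h2)
  have hfd : DifferentiableOn ℂ f (ball c R \ {c}) := fun z hz ↦ (hRh z hz).1.differentiableWithinAt
  have hgd : DifferentiableOn ℂ g (ball c R \ {c}) :=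
    differentiableOn_punctured_congr (fun z hz ↦ (hRh z hz).1) (fun z hz ↦ (hRh z hz).2)
  rw [residueAt_eq_circleResidue hfd (half_pos hR) (half_lt_self hR),
    residueAt_eq_circleResidue hgd (half_pos hR) (half_lt_self hR), circleResidue, circleResidue]
  congr 1
  refine circleIntegral.integral_congr (half_pos hR).le fun z hz ↦ ?_
  rw [mem_sphere] at hz
  exact ((hRh z (mem_ball_diff_singleton (half_pos hR) hz.ge (by rw [hz]; exact half_lt_self hR))).2).symm

/-- `Res_c (f + g) = Res_c f + Res_c g`. [folklore] -/
theorem residueAt_add {f g : ℂ → ℂ} {c : ℂ} (hf : ∀ᶠ z in 𝓝[≠] c, DifferentiableAt ℂ f z)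
    (hg : ∀ᶠ z in 𝓝[≠] c, DifferentiableAt ℂ g z) :
    residueAt (f + g) c = residueAt f c + residueAt g c := by
  obtain ⟨R, hR, hRh⟩ := exists_ball_forall_of_eventually (hf.and hg)
  have hfd : DifferentiableOn ℂ f (ball c R \ {c}) := fun z hz ↦ (hRh z hz).1.differentiableWithinAt
  have hgd : DifferentiableOn ℂ g (ball c R \ {c}) := fun z hz ↦ (hRh z hz).2.differentiableWithinAt
  have hr := half_pos hR
  have hrR := half_lt_self hR
  rw [residueAt_eq_circleResidue (hfd.add hgd) hr hrR, residueAt_eq_circleResidue hfd hr hrR,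
    residueAt_eq_circleResidue hgd hr hrR, circleResidue, circleResidue, circleResidue]
  have hsub : sphere c (R / 2) ⊆ ball c R \ {c} := fun z hz ↦
    mem_ball_diff_singleton hr (by rw [mem_sphere] at hz; exact hz.ge) (by rw [mem_sphere] at hz; rw [hz]; exact hrR)
  rw [show (fun z ↦ (f + g) z) = fun z ↦ f z + g z from rfl,
    circleIntegral.integral_add ((hfd.continuousOn.mono hsub).circleIntegrable hr.le)
      ((hgd.continuousOn.mono hsub).circleIntegrable hr.le)]
  ring

/-- `Res_c (a · f) = a · Res_c f`. [folklore] -/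
theorem residueAt_const_mul {f : ℂ → ℂ} {c : ℂ} (hf : ∀ᶠ z in 𝓝[≠] c, DifferentiableAt ℂ f z) (a : ℂ) :
    residueAt (fun z ↦ a * f z) c = a * residueAt f c := by
  obtain ⟨R, hR, hRh⟩ := exists_ball_forall_of_eventually hf
  have hfd : DifferentiableOn ℂ f (ball c R \ {c}) := fun z hz ↦ (hRh z hz).differentiableWithinAt
  have hafd : DifferentiableOn ℂ (fun z ↦ a * f z) (ball c R \ {c}) := hfd.const_mul a
  rw [residueAt_eq_circleResidue hafd (half_pos hR) (half_lt_self hR),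
    residueAt_eq_circleResidue hfd (half_pos hR) (half_lt_self hR), circleResidue, circleResidue,
    circleIntegral.integral_const_mul]
  ring

/-- `Res_c (−f) = −Res_c f`. [folklore] -/
theorem residueAt_neg {f : ℂ → ℂ} {c : ℂ} (hf : ∀ᶠ z in 𝓝[≠] c, DifferentiableAt ℂ f z) :
    residueAt (fun z ↦ -f z) c = -residueAt f c := by
  have := residueAt_const_mul hf (-1)
  simp only [neg_mul, one_mul] at this
  exact this

/-- `Res_c (f − g) = Res_c f − Res_c g`. [folklore] -/
theorem residueAt_sub {f g : ℂ → ℂ} {c : ℂ} (hf : ∀ᶠ z in 𝓝[≠] c, DifferentiableAt ℂ f z)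
    (hg : ∀ᶠ z in 𝓝[≠] c, DifferentiableAt ℂ g z) :
    residueAt (f - g) c = residueAt f c - residueAt g c := by
  rw [sub_eq_add_neg, residueAt_add hf (hg.mono fun z h ↦ h.neg), show (-g) = fun z ↦ -g z from rfl,
    residueAt_neg hg]
  ring

/-- `Res_c ∑ fᵢ = ∑ Res_c fᵢ`. [folklore] -/
theorem residueAt_sum {ι : Type*} (s : Finset ι) {f : ι → ℂ → ℂ} {c : ℂ}
    (hf : ∀ i ∈ s, ∀ᶠ z in 𝓝[≠] c, DifferentiableAt ℂ (f i) z) :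
    residueAt (fun z ↦ ∑ i ∈ s, f i z) c = ∑ i ∈ s, residueAt (f i) c := by
  classical
  induction s using Finset.induction_on with
  | empty => simpa using residueAt_of_analyticAt (f := fun _ ↦ (0 : ℂ)) (c := c) analyticAt_const
  | insert i s hi ih =>
    rw [Finset.sum_insert hi, ← ih (fun j hj ↦ hf j (Finset.mem_insert_of_mem hj))]
    have h1 := hf i (Finset.mem_insert_self i s)
    have h2 : ∀ᶠ z in 𝓝[≠] c, DifferentiableAt ℂ (fun z ↦ ∑ j ∈ s, f j z) z := by
      have : ∀ j ∈ s, ∀ᶠ z in 𝓝[≠] c, DifferentiableAt ℂ (f j) z :=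
        fun j hj ↦ hf j (Finset.mem_insert_of_mem hj)
      have hall : ∀ᶠ z in 𝓝[≠] c, ∀ j ∈ s, DifferentiableAt ℂ (f j) z :=
        (s.eventually_all).mpr this
      filter_upwards [hall] with z hz
      exact DifferentiableAt.fun_sum fun j hj ↦ hz j hj
    rw [← residueAt_add h1 h2]
    congr 1
    funext z
    rw [Finset.sum_insert hi]
    rfl

/-! ### The model residues: `(z − c)⁻¹` and `(z − c)ⁿ` -/

/-- **`Res_c (z − c)⁻¹ = 1`.** [folklore] -/
theorem residueAt_inv_sub_self (c : ℂ) : residueAt (fun z ↦ (z - c)⁻¹) c = 1 := by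
  have hf : DifferentiableOn ℂ (fun z : ℂ ↦ (z - c)⁻¹) (ball c 1 \ {c}) := fun z hz ↦
    ((differentiableAt_id.sub_const c).inv (sub_ne_zero.mpr hz.2)).differentiableWithinAt
  rw [residueAt_eq_circleResidue hf one_half_pos (by norm_num), circleResidue,
    circleIntegral.integral_sub_center_inv c (by norm_num), inv_mul_cancel₀]
  simp [Real.pi_ne_zero, I_ne_zero]

/-- **`Res_c (z − c)ⁿ = 0` for `n ≠ −1`.** [folklore] -/
theorem residueAt_zpow_sub_self (c : ℂ) {n : ℤ} (hn : n ≠ -1) : residueAt (fun z ↦ (z - c) ^ n) c = 0 := by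
  have hf : DifferentiableOn ℂ (fun z : ℂ ↦ (z - c) ^ n) (ball c 1 \ {c}) := fun z hz ↦
    ((differentiableAt_id.sub_const c).zpow (Or.inl (sub_ne_zero.mpr hz.2))).differentiableWithinAt
  rw [residueAt_eq_circleResidue hf one_half_pos (by norm_num), circleResidue,
    circleIntegral.integral_sub_zpow_of_ne hn, mul_zero]

/-! ### Residues of derivatives vanish -/

/-- **The residue of a derivative is zero**: if `F` is holomorphic on a punctured neighbourhood of
`c` then `Res_c F' = 0` (`∮ F' = 0` over a closed curve). [folklore] -/
theorem residueAt_deriv {F : ℂ → ℂ} {c : ℂ} (hF : ∀ᶠ z in 𝓝[≠] c, DifferentiableAt ℂ F z) :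
    residueAt (deriv F) c = 0 := by
  obtain ⟨R, hR, hRh⟩ := exists_ball_forall_of_eventually hF
  have hopen : IsOpen (ball c R \ {c}) := isOpen_ball.sdiff isClosed_singleton
  have hFd : DifferentiableOn ℂ F (ball c R \ {c}) := fun z hz ↦ (hRh z hz).differentiableWithinAt
  have hF'd : DifferentiableOn ℂ (deriv F) (ball c R \ {c}) :=
    (hFd.analyticOnNhd hopen).deriv.differentiableOn
  rw [residueAt_eq_circleResidue hF'd (half_pos hR) (half_lt_self hR), circleResidue]
  rw [circleIntegral.integral_eq_zero_of_hasDerivWithinAt (f := F) (half_pos hR).le (fun z hz ↦ ?_), mul_zero]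
  have hz' : z ∈ ball c R \ {c} := by
    rw [mem_sphere] at hz
    exact mem_ball_diff_singleton (half_pos hR) hz.ge (by rw [hz]; exact half_lt_self hR)
  exact (hRh z hz').hasDerivAt.hasDerivWithinAt

/-! ### The logarithmic derivative: `Res_c f'/f = ord_c f` -/

/-- An analytic function that is nonzero at `c` is nonzero on a neighbourhood (used for denominators).
[folklore] -/
theorem eventually_ne_zero_of_analyticAt {g : ℂ → ℂ} {c : ℂ} (hg : AnalyticAt ℂ g c) (h0 : g c ≠ 0) :
    ∀ᶠ z in 𝓝 c, g z ≠ 0 :=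
  hg.continuousAt.eventually_ne h0

/-- **Residue of the logarithmic derivative** (meromorphic form): if `f = (z−c)^m · g` on a
punctured neighbourhood of `c` with `g` analytic and non-vanishing at `c` (`m ∈ ℤ` the order of the
zero or pole) then `Res_c (f'/f) = m` (`f'/f = m/(z−c) + g'/g`; Ahlfors Ch. 4 §5.2, Conway V.3.4).
[folklore] -/
theorem residueAt_logDeriv_of_eventuallyEq {f g : ℂ → ℂ} {c : ℂ} {m : ℤ} (hga : AnalyticAt ℂ g c)
    (hg0 : g c ≠ 0) (hfg : f =ᶠ[𝓝[≠] c] fun z ↦ (z - c) ^ m * g z) :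
    residueAt (fun z ↦ deriv f z / f z) c = m := by
  -- a punctured disc on which `f = (z-c)^m g`, `g ≠ 0`, `g` analytic
  have hgne : ∀ᶠ z in 𝓝[≠] c, g z ≠ 0 :=
    (eventually_ne_zero_of_analyticAt hga hg0).filter_mono nhdsWithin_le_nhds
  have hgan : ∀ᶠ z in 𝓝[≠] c, AnalyticAt ℂ g z := hga.eventually_analyticAt.filter_mono nhdsWithin_le_nhds
  have hfg' : ∀ᶠ z in 𝓝[≠] c, f z = (z - c) ^ m * g z := hfg
  obtain ⟨ε, hε, hU⟩ := exists_ball_forall_of_eventually (hfg'.and (hgne.and hgan))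
  -- the formula for `f'/f` on the punctured disc
  have key : ∀ z ∈ ball c ε \ {c}, deriv f z / f z = m * (z - c)⁻¹ + deriv g z / g z := by
    intro z hz
    have hzc : z - c ≠ 0 := sub_ne_zero.mpr hz.2
    obtain ⟨-, hgz, hgaz⟩ := hU z hz
    have hopen : ball c ε \ {c} ∈ 𝓝 z := (isOpen_ball.sdiff isClosed_singleton).mem_nhds hz
    have hloc : f =ᶠ[𝓝 z] fun w ↦ (w - c) ^ m * g w := by
      filter_upwards [hopen] with w hw using (hU w hw).1
    have hderiv : deriv f z = m * (z - c) ^ (m - 1) * g z + (z - c) ^ m * deriv g z := by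
      rw [hloc.deriv_eq]
      have h1 : HasDerivAt (fun w ↦ (w - c) ^ m) (m * (z - c) ^ (m - 1)) z := by
        have := (hasDerivAt_zpow m (z - c) (Or.inl hzc)).comp z ((hasDerivAt_id' z).sub_const c)
        rwa [mul_one] at this
      have h2 : HasDerivAt (fun w ↦ (w - c) ^ m * g w) _ z := h1.mul hgaz.differentiableAt.hasDerivAt
      rw [h2.deriv]
    rw [hderiv, hloc.self_of_nhds]
    dsimp only
    have : (z - c) ^ m = (z - c) ^ (m - 1) * (z - c) := by
      rw [← zpow_add_one₀ hzc, sub_add_cancel]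
    rw [this]
    have hw : (z - c) ^ (m - 1) ≠ 0 := zpow_ne_zero _ hzc
    generalize (z - c) ^ (m - 1) = w at hw ⊢
    field_simp
  -- residues
  have h0 : ∀ᶠ z in 𝓝[≠] c, DifferentiableAt ℂ (fun z ↦ (z - c)⁻¹) z :=
    eventually_of_forall_ball one_pos fun z hz ↦
      (differentiableAt_id.sub_const c).inv (sub_ne_zero.mpr hz.2)
  have h1 : ∀ᶠ z in 𝓝[≠] c, DifferentiableAt ℂ (fun z ↦ (m : ℂ) * (z - c)⁻¹) z :=
    h0.mono fun z hz ↦ hz.const_mul _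
  have h2an : AnalyticAt ℂ (fun z ↦ deriv g z / g z) c := hga.deriv.div hga hg0
  have h2 : ∀ᶠ z in 𝓝[≠] c, DifferentiableAt ℂ (fun z ↦ deriv g z / g z) z :=
    (h2an.eventually_analyticAt.mono fun z hz ↦ hz.differentiableAt).filter_mono nhdsWithin_le_nhds
  have hsum : ∀ᶠ z in 𝓝[≠] c, DifferentiableAt ℂ
      (fun z ↦ (m : ℂ) * (z - c)⁻¹ + deriv g z / g z) z := by
    filter_upwards [h1, h2] with z a b using a.add b
  rw [residueAt_congr hsum ((eventually_of_forall_ball hε key).mono fun z hz ↦ hz.symm)]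
  rw [show (fun z ↦ (m : ℂ) * (z - c)⁻¹ + deriv g z / g z) =
      (fun z ↦ (m : ℂ) * (z - c)⁻¹) + fun z ↦ deriv g z / g z from rfl,
    residueAt_add h1 h2, residueAt_const_mul h0 (m : ℂ),
    residueAt_inv_sub_self, residueAt_of_analyticAt h2an]
  ring

/-- **Residue of the logarithmic derivative** (holomorphic form): if `f` is analytic at `c` of
finite order `n` then `Res_c (f'/f) = n` (Ahlfors Ch. 4 §5.2; Conway V.3.4). [folklore] -/
theorem residueAt_logDeriv {f : ℂ → ℂ} {c : ℂ} (hf : AnalyticAt ℂ f c) {n : ℕ}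
    (hn : analyticOrderAt f c = n) : residueAt (fun z ↦ deriv f z / f z) c = n := by
  obtain ⟨g, hga, hg0, hfg⟩ := (hf.analyticOrderAt_eq_natCast).mp hn
  have hfg' : f =ᶠ[𝓝[≠] c] fun z ↦ (z - c) ^ (n : ℤ) * g z :=
    (hfg.filter_mono nhdsWithin_le_nhds).mono fun z hz ↦ by
      show f z = (z - c) ^ (n : ℤ) * g z
      rw [zpow_natCast, ← smul_eq_mul]; exact hz
  have := residueAt_logDeriv_of_eventuallyEq hga hg0 hfg'
  exact_mod_cast this

/-! ### Principal parts and the residue as the coefficient of `(z − c)⁻¹` -/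

/-- **Taylor truncation**: an analytic `F` is `∑_{i<m} aᵢ (z−c)ⁱ + (z−c)^m G` near `c` with `G`
analytic. [folklore] -/
theorem exists_taylor_truncation {F : ℂ → ℂ} {c : ℂ} (hF : AnalyticAt ℂ F c) (m : ℕ) :
    ∃ (a : ℕ → ℂ) (G : ℂ → ℂ), AnalyticAt ℂ G c ∧
      ∀ᶠ z in 𝓝 c, F z = (∑ i ∈ Finset.range m, a i * (z - c) ^ i) + (z - c) ^ m * G z := by
  induction m generalizing F with
  | zero => exact ⟨fun _ ↦ 0, F, hF, Eventually.of_forall fun z ↦ by simp⟩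
  | succ m ih =>
    -- `F = F c + (z - c) dslope F c`
    obtain ⟨p, hp⟩ := hF
    have hds : AnalyticAt ℂ (dslope F c) c := ⟨_, hp.has_fpower_series_dslope_fslope⟩
    obtain ⟨a, G, hGa, hG⟩ := ih hds
    refine ⟨fun i ↦ if i = 0 then F c else a (i - 1), G, hGa, ?_⟩
    filter_upwards [hG] with z hz
    have hF' : F z = F c + (z - c) * dslope F c z := by
      by_cases hzc : z = c
      · subst hzc; simp
      · rw [dslope_of_ne _ hzc, slope_def_field]
        field_simp
        ring
    rw [hF', hz, Finset.sum_range_succ', mul_add, Finset.mul_sum]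
    simp only [if_true, pow_zero, mul_one, Nat.add_one_ne_zero, if_false, Nat.add_sub_cancel]
    have : ∀ i ∈ Finset.range m, (z - c) * (a i * (z - c) ^ i) = a i * (z - c) ^ (i + 1) := by
      intro i _; ring
    rw [Finset.sum_congr rfl this]; ring

/-- **Principal part of a meromorphic germ**: `f = ∑_{k<m} b_k (z−c)^{−(k+1)} + G` on a punctured
neighbourhood, `G` analytic at `c`. [folklore] -/
theorem exists_principalPart {f : ℂ → ℂ} {c : ℂ} (hf : MeromorphicAt f c) :
    ∃ (m : ℕ) (b : ℕ → ℂ) (G : ℂ → ℂ), AnalyticAt ℂ G c ∧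
      ∀ᶠ z in 𝓝[≠] c, f z = (∑ k ∈ Finset.range m, b k * (z - c) ^ (-(k + 1 : ℤ))) + G z := by
  obtain ⟨m, hF⟩ := hf
  obtain ⟨a, G, hGa, hG⟩ := exists_taylor_truncation hF m
  refine ⟨m, fun k ↦ a (m - 1 - k), G, hGa, ?_⟩
  have hG' : ∀ᶠ z in 𝓝[≠] c, (z - c) ^ m • f z = (∑ i ∈ Finset.range m, a i * (z - c) ^ i) + (z - c) ^ m * G z :=
    hG.filter_mono nhdsWithin_le_nhds
  filter_upwards [hG', self_mem_nhdsWithin] with z hz hzc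
  have hzc' : z - c ≠ 0 := sub_ne_zero.mpr hzc
  have hf' : f z = (z - c) ^ (-(m : ℤ)) * ((∑ i ∈ Finset.range m, a i * (z - c) ^ i) + (z - c) ^ m * G z) := by
    rw [← hz, smul_eq_mul, ← mul_assoc, zpow_neg, zpow_natCast, inv_mul_cancel₀ (pow_ne_zero _ hzc'), one_mul]
  rw [hf', mul_add, Finset.mul_sum]
  congr 1
  · -- reindex `i ↦ m - 1 - i`
    refine Finset.sum_nbij' (fun i ↦ m - 1 - i) (fun k ↦ m - 1 - k) ?_ ?_ ?_ ?_ ?_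
    · intro i hi; simp only [Finset.mem_range] at hi ⊢; omega
    · intro k hk; simp only [Finset.mem_range] at hk ⊢; omega
    · intro i hi; simp only [Finset.mem_range] at hi; omega
    · intro k hk; simp only [Finset.mem_range] at hk; omega
    · intro i hi
      simp only [Finset.mem_range] at hi
      have h1 : m - 1 - (m - 1 - i) = i := by omega
      rw [h1, mul_left_comm]
      congr 1
      rw [← zpow_natCast, ← zpow_add₀ hzc']
      congr 1
      omega
  · rw [← mul_assoc, zpow_neg, zpow_natCast, inv_mul_cancel₀ (pow_ne_zero _ hzc'), one_mul]

/-- **The residue is the coefficient of `(z − c)⁻¹` in the principal part.** [folklore] -/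
theorem residueAt_eq_of_principalPart {f G : ℂ → ℂ} {c : ℂ} {m : ℕ} {b : ℕ → ℂ} (hG : AnalyticAt ℂ G c)
    (h : ∀ᶠ z in 𝓝[≠] c, f z = (∑ k ∈ Finset.range m, b k * (z - c) ^ (-(k + 1 : ℤ))) + G z) :
    residueAt f c = if 0 < m then b 0 else 0 := by
  have hzp : ∀ k : ℕ, ∀ᶠ z in 𝓝[≠] c, DifferentiableAt ℂ (fun z ↦ (z - c) ^ (-(k + 1 : ℤ))) z := fun k ↦
    eventually_of_forall_ball one_pos fun z hz ↦
      ((differentiableAt_id.sub_const c).zpow (Or.inl (sub_ne_zero.mpr hz.2)))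
  have hterm : ∀ k, ∀ᶠ z in 𝓝[≠] c, DifferentiableAt ℂ (fun z ↦ b k * (z - c) ^ (-(k + 1 : ℤ))) z :=
    fun k ↦ (hzp k).mono fun z hz ↦ hz.const_mul _
  have hP : ∀ᶠ z in 𝓝[≠] c, DifferentiableAt ℂ
      (fun z ↦ ∑ k ∈ Finset.range m, b k * (z - c) ^ (-(k + 1 : ℤ))) z := by
    have hall : ∀ᶠ z in 𝓝[≠] c, ∀ k ∈ Finset.range m,
        DifferentiableAt ℂ (fun z ↦ b k * (z - c) ^ (-(k + 1 : ℤ))) z :=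
      ((Finset.range m).eventually_all).mpr fun k _ ↦ hterm k
    filter_upwards [hall] with z hz using DifferentiableAt.fun_sum hz
  have hGd : ∀ᶠ z in 𝓝[≠] c, DifferentiableAt ℂ G z :=
    (hG.eventually_analyticAt.mono fun z hz ↦ hz.differentiableAt).filter_mono nhdsWithin_le_nhds
  have hsum : ∀ᶠ z in 𝓝[≠] c, DifferentiableAt ℂ
      (fun z ↦ (∑ k ∈ Finset.range m, b k * (z - c) ^ (-(k + 1 : ℤ))) + G z) z := by
    filter_upwards [hP, hGd] with z a b' using a.add b'
  rw [residueAt_congr hsum (h.mono fun z hz ↦ hz.symm),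
    show (fun z ↦ (∑ k ∈ Finset.range m, b k * (z - c) ^ (-(k + 1 : ℤ))) + G z) =
      (fun z ↦ ∑ k ∈ Finset.range m, b k * (z - c) ^ (-(k + 1 : ℤ))) + G from rfl,
    residueAt_add hP hGd, residueAt_of_analyticAt hG, add_zero,
    residueAt_sum _ (fun k _ ↦ hterm k)]
  have hk : ∀ k ∈ Finset.range m, residueAt (fun z ↦ b k * (z - c) ^ (-(k + 1 : ℤ))) c =
      if k = 0 then b 0 else 0 := by
    intro k _
    rw [residueAt_const_mul (hzp k) (b k)]
    split_ifs with h0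
    · subst h0
      simp only [Nat.cast_zero, zero_add, zpow_neg, zpow_one]
      rw [residueAt_inv_sub_self, mul_one]
    · rw [residueAt_zpow_sub_self c (by omega), mul_zero]
  rw [Finset.sum_congr rfl hk]
  split_ifs with hm
  · simp [Finset.sum_ite_eq', hm]
  · simp only [not_lt, Nat.le_zero] at hm
    subst hm; simp

end Literature.Analysis.Complex

end
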